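import Summits.CriticalPhenomena.PercolationContinuityZ3.Theorems.PercNearOneGluingNoHeavyLowerTailSahiGridPatternTopCubeGood
import Summits.CriticalPhenomena.PercolationContinuityZ3.Theorems.PercNearOneGluingNoHeavyLowerTailSahiGridPatternThreeCoord
import Summits.CriticalPhenomena.PercolationContinuityZ3.Theorems.PercNearOneGluingNoHeavyLowerTailSahiGridPatternTwoOrthantGeneral

/-!
# `NoHeavyLowerTail` (crux stmt-CriticalPhenomena-4575), Sahi programme P1: **TOP-CUBE × GOOD IN EITHER ORDER, AND ITS UNCONDITIONAL INSTANCES** —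
# the block product `V × S` (good block first, top-cube block last) via the tree's axis re-indexing transfer, and `S × V` good for every `≤ 3`-junta `V`

Support file (Sahi cell, seat `prim-sahi-p1`, generation 46; `--supports stmt-CriticalPhenomena-4575`).  Pure proofs, no definitions, no `sorry`, standard axioms.
Vocabulary of `…SahiGridPattern{,AllDim,CellForm,ThreeCoord,TwoOrthantGeneral,TopCubeGood}` (`Pd`, `tcD`, `sStarD`, `glue`, `freeOf`, `cellOf`).

THE MATHEMATICS.  Goodness of a first slot is invariant under re-indexing the axes (`…TwoOrthantGeneral.sStarD_nonneg_transfer`, any equivalence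
`Fin d' ≃ Fin d`).  Applied to the rotation `finAddFlip : Fin (n+k) ≃ Fin (k+n)` (`comp_finAddFlip_eq_glue`: `x ∘ finAddFlip = glue (cellOf x) (freeOf x)`)
this turns generation 46's TOP-CUBE × GOOD theorem (`sStarD_blockAnd_topCube_nonneg_of_good`, top-cube block on the FIRST `n` axes) into the same statement
with the top-cube block on the LAST `n` axes: for a good up-set `V ⊆ [3]^k` and an up-set `S ⊆ [3]^n` with no zero coordinate, the block product `V × S ⊆ [3]^{k+n}`
(`glue z ξ ∈ A' ↔ z ∈ V ∧ ξ ∈ S`) is good (`sStarD_blockAnd_good_topCube_nonneg`).  So 'good × top-cube' is good in either order.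
UNCONDITIONAL INSTANCES (`sStarD_blockAnd_topCube_depOn3_nonneg`, kernel): every up-set depending on `≤ 3` coordinates is good in every dimension
(`…ThreeCoord.sStarD_nonneg_of_depOn3`), so `S × V` is a good first slot of `[3]^{n+k}` for EVERY top-cube up-set `S ⊆ [3]^n` and every `≤ 3`-junta up-set
`V ⊆ [3]^k` — e.g. all `S × V ⊆ [3]^5, [3]^6, …` with `S ⊆ {1,2}^n` non-principal and `V ⊆ [3]^3` arbitrary (new instances of `PatternPos 5, 6, …` on named slots).
HONEST LABEL: `PatternPos d` (`d ≥ 5`) and `T×` for general outer blocks remain OPEN; nothing here asserts them. [this work]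
-/

namespace Summit.CriticalPhenomena.PercolationContinuityZ3.Theorems.SahiGridPattern

open Finset SahiGrid3
open scoped BigOperators

variable {n k : ℕ} {S : Finset (Pd n)} {V : Finset (Pd k)}

/-- Rotating the blocks: for `x ∈ [3]^{k+n}`, the re-indexed point `x ∘ finAddFlip : [3]^{n+k}` is `glue (cellOf x) (freeOf x)` — its first `n`
coordinates are the last `n` of `x`. [this work] -/
theorem comp_finAddFlip_eq_glue (x : Pd (k + n)) :
    (x ∘ (finAddFlip : Fin (n + k) ≃ Fin (k + n)) : Pd (n + k)) = glue (cellOf x) (freeOf x) := by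
  funext i
  refine Fin.addCases (fun a => ?_) (fun b => ?_) i
  · simp only [Function.comp_apply, finAddFlip_apply_castAdd]
    unfold glue; rw [Fin.append_left]; rfl
  · simp only [Function.comp_apply, finAddFlip_apply_natAdd]
    unfold glue; rw [Fin.append_right]; rfl

/-- **TOP-CUBE × GOOD IN THE OTHER ORDER (every `n, k`).**  For a GOOD up-set `V ⊆ [3]^k`, an up-set `S ⊆ [3]^n` with no zero coordinate, and
`A' = V × S ⊆ [3]^{k+n}` (`glue z ξ ∈ A' ↔ z ∈ V ∧ ξ ∈ S`): `0 ≤ sStarD A' P Q` for all up-sets `P, Q ⊆ [3]^{k+n}`. [this work] -/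
theorem sStarD_blockAnd_good_topCube_nonneg (hS : IsUpperSet (S : Set (Pd n))) (htop : ∀ ξ ∈ S, ∀ a, ξ a ≠ 0)
    (hV : IsUpperSet (V : Set (Pd k))) {A' : Finset (Pd (k + n))} (hA' : ∀ z ξ, glue z ξ ∈ A' ↔ (z ∈ V ∧ ξ ∈ S))
    (hgood : ∀ X X' : Finset (Pd k), IsUpperSet (X : Set (Pd k)) → IsUpperSet (X' : Set (Pd k)) → 0 ≤ sStarD V X X')
    {P Q : Finset (Pd (k + n))} (hP : IsUpperSet (P : Set (Pd (k + n)))) (hQ : IsUpperSet (Q : Set (Pd (k + n)))) :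
    0 ≤ sStarD A' P Q := by
  classical
  -- the block product in the order `S × V`
  let A : Finset (Pd (n + k)) := univ.filter fun y => freeOf y ∈ S ∧ cellOf y ∈ V
  have hA : ∀ ξ z, glue ξ z ∈ A ↔ (ξ ∈ S ∧ z ∈ V) := by
    intro ξ z; simp only [A, Finset.mem_filter, Finset.mem_univ, true_and, freeOf_glue, cellOf_glue]
  have hgoodA : ∀ B C : Finset (Pd (n + k)), IsUpperSet (B : Set (Pd (n + k))) → IsUpperSet (C : Set (Pd (n + k))) → 0 ≤ sStarD A B C :=
    fun B C hB hC => sStarD_blockAnd_topCube_nonneg_of_good hS htop hV hA hgood hB hC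
  -- transfer along the rotation `finAddFlip`
  refine sStarD_nonneg_transfer (finAddFlip : Fin (n + k) ≃ Fin (k + n)) hgoodA (fun x => ?_) P Q hP hQ
  rw [comp_finAddFlip_eq_glue, hA, ← glue_freeOf_cellOf x, hA', freeOf_glue, cellOf_glue]
  exact and_comm

/-- **UNCONDITIONAL INSTANCES (kernel; every `n, k`)**: for a top-cube up-set `S ⊆ [3]^n` and an up-set `V ⊆ [3]^k` depending on at most three coordinates
(`J.card ≤ 3`), the block product `S × V` is good: `0 ≤ sStarD A P Q` for all up-sets `P, Q ⊆ [3]^{n+k}` (by `sStarD_nonneg_of_depOn3`, every `≤ 3`-junta is good). [this work] -/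
theorem sStarD_blockAnd_topCube_depOn3_nonneg (hS : IsUpperSet (S : Set (Pd n))) (htop : ∀ ξ ∈ S, ∀ a, ξ a ≠ 0)
    (hV : IsUpperSet (V : Set (Pd k))) (J : Finset (Fin k)) (hJ : J.card ≤ 3)
    (hdep : ∀ x y : Pd k, (∀ t ∈ J, x t = y t) → (x ∈ V ↔ y ∈ V))
    {A : Finset (Pd (n + k))} (hA : ∀ ξ z, glue ξ z ∈ A ↔ (ξ ∈ S ∧ z ∈ V))
    {P Q : Finset (Pd (n + k))} (hP : IsUpperSet (P : Set (Pd (n + k)))) (hQ : IsUpperSet (Q : Set (Pd (n + k)))) :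
    0 ≤ sStarD A P Q :=
  sStarD_blockAnd_topCube_nonneg_of_good hS htop hV hA (fun X X' hX hX' => sStarD_nonneg_of_depOn3 J hJ hV hdep X X' hX hX') hP hQ

/-- In particular (`k = 3`, `J = univ`): `S × V ⊆ [3]^{n+3}` is good for every top-cube up-set `S ⊆ [3]^n` and EVERY up-set `V ⊆ [3]^3`. [this work] -/
theorem sStarD_blockAnd_topCube_three_nonneg (hS : IsUpperSet (S : Set (Pd n))) (htop : ∀ ξ ∈ S, ∀ a, ξ a ≠ 0)
    {V : Finset (Pd 3)} (hV : IsUpperSet (V : Set (Pd 3)))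
    {A : Finset (Pd (n + 3))} (hA : ∀ ξ z, glue ξ z ∈ A ↔ (ξ ∈ S ∧ z ∈ V))
    {P Q : Finset (Pd (n + 3))} (hP : IsUpperSet (P : Set (Pd (n + 3)))) (hQ : IsUpperSet (Q : Set (Pd (n + 3)))) :
    0 ≤ sStarD A P Q :=
  sStarD_blockAnd_topCube_depOn3_nonneg hS htop hV (Finset.univ : Finset (Fin 3)) (by simp) (fun x y h => by
    have : x = y := funext fun t => h t (Finset.mem_univ t)
    rw [this]) hA hP hQ

end Summit.CriticalPhenomena.PercolationContinuityZ3.Theorems.SahiGridPattern
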